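import Literature.LinearAlgebra.FreeModule.AlternatingElementaryDivisors
import HarnessLib

/-!
# `Sp_{2n}(ℤ)` is transitive on primitive vectors of `ℤ^{2n}` (Siegel's lemma), and the first reduction step of
# Goresky–Tai 2017, Lemma 45

Goresky–Tai, *Real structures on ordinary abelian varieties*, arXiv:1701.07742, Appendix §19.2, proof of Lemma 45,
p0044, print (verbatim):

> «There exists a vector `v ∈ ℤ^{2n}` that is primitive and has `τ(v) = v`. (Choose a rational vector `u` so that
> `τ(u) = u`, clear denominators to obtain an integral vector, and divide by common divisors to obtain a primitive
> vector.)  We claim there exists `g ∈ Sp_{2n}(ℤ)` so that `gv = e_1 = (1, 0, ⋯, 0)`.  This is a lemma of Siegel (see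
> [Freitag] Satz A5.4) but here is an outline.  Let `v = (a_1, ⋯, a_n, b_1, ⋯, b_n)`.  Acting by permutations we can
> arrange that `|a_1| < |a_j|` for `2 ≤ j ≤ n`.  Acting by `(A 0; 0 ᵗA⁻¹)` we can subtract multiplies of `a_1` from
> the other `a_i` and continuing in this way (by the Euclidean algorithm) we can eventually arrange that `a_j = 0` for
> `2 ≤ j ≤ n`.  Similarly, acting by `(I 0; S I)` we can arrange that `|b_i| < |a_1|` for `1 ≤ i ≤ n`.  Then using
> `(0 I; −I 0)` we can switch the `a`'s and the `b`'s.  Continuing in this way we can arrange that `b_j = 0` for all `j`.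
> This implies that `a_1` is a unit, so we can adjust it to equal one.»

## What is formalized, and how

For a finite index type `l` (`n = #l`), Mathlib's `J = Matrix.J l ℤ = (0 −1; 1 0)` and
`Sp_{2n}(ℤ) = Matrix.symplecticGroup l ℤ`; «primitive» is taken in Bézout form, `v ⬝ c = 1` for some integral `c`
(equivalent to `gcd(v_k) = 1`):

* ★ `exists_mem_symplecticGroup_mulVec_single_eq` — for primitive `v` and any `i₀ : l` there is `g ∈ Sp_{2n}(ℤ)` with
  `g e_{inl i₀} = v`; ★ `exists_mem_symplecticGroup_mulVec_eq_single` — «there exists `g ∈ Sp_{2n}(ℤ)` so that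
  `gv = e_1`»; ★ `exists_mem_symplecticGroup_mulVec_eq` — TRANSITIVITY on primitive vectors;
  `exists_dotProduct_eq_one_of_mem_symplecticGroup` — conversely the columns of an integral symplectic matrix are
  primitive;
* §4, the surrounding sentences of the printed proof: `exists_eq_smul_primitive` («divide by common divisors to obtain
  a primitive vector»: Bézout form via `Finset.gcd_eq_sum_mul`), ★ `exists_primitive_mulVec_eq_self` («There exists
  a vector `v ∈ ℤ^{2n}` that is primitive and has `τ(v) = v`», for any integral `τ` with `τ² = 1`, `τ ≠ −1`),
  `row_inr_eq_of_mulVec_single_eq` and ★ `exists_symplectic_conj_mulVec_single_eq_self` («It follows that `τ` is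
  `Sp_{2n}(ℤ)` conjugate to a matrix `(A B; C D)` where `A = (1 *; 0 A₁)`, … `C = (0 0; 0 C₁)`, `D = (−1 0; * D₁)`»:
  an integral involution of multiplier `−1` is `Sp_{2n}(ℤ)`-conjugate to one fixing `e_{inl i₀}` whose `(inr i₀)`-row
  is `−ᵗe_{inr i₀}`, again an involution of multiplier `−1`; the ensuing induction on `n` is not formalized here).

The proof formalized is NOT GT's Euclidean-algorithm outline but the lattice-theoretic one (O'Meara §82F–§82G: a
primitive vector of a unimodular lattice lies in a hyperbolic plane splitting the lattice): with `B(x, y) = ᵗxJy`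
(alternating, unimodular on `ℤ^{2n}` since `J² = −1`), `w = −Jc` is a hyperbolic partner of `v` (`B(v, w) = v ⬝ c = 1`);
`Λ′ = {y | B(v, y) = B(w, y) = 0}` satisfies `ℤ^{2n} = ℤv ⊕ ℤw ⊕ Λ′` (`z ↦ z + B(w, z)v − B(v, z)w`); `B|Λ′` is
alternating and non-degenerate, so the tree's integral Frobenius theorem
(`Literature.LinearAlgebra.FreeModule.exists_frobeniusBasis`, Adkins–Weintraub Thm. 6.2.35) gives a basis
`(λᵢ, μᵢ)` of `Λ′` with `B(λᵢ, μⱼ) = dᵢδᵢⱼ`; unimodularity of `B` on `ℤ^{2n}` (every functional is `B(Jc_f, ·)`)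
forces every `dᵢ = 1`; the matrix with columns `v, λ` (first block) and `−w, −μ` (second block; the sign matches
`J = (0 −1; 1 0)`) is then symplectic and maps `e_{inl i₀}` to `v`.  The private
`exists_symplectic_families_cons` packages this (families `u = (v, λ)`, `u′ = (w, μ)` with the unimodular
symplectic relations and `#u = #l`).  THEOREMS ONLY; no definition, instance, notation or named fact.

The tree already has the analogue over the valuation ring of a discretely valued field
(`Literature/NumberTheory/Automorphic/SymplecticGroupPrimitiveVectors`); this file is the `ℤ` case GT use.

## References

* [GoreskyTai2017RealStructuresOrdinary] M. Goresky, Y.-S. Tai, *Real structures on ordinary abelian varieties*,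
  arXiv:1701.07742 (2017), Appendix §19.2, proof of Lemma 45 (citing E. Freitag, *Siegelsche Modulfunktionen*,
  Satz A5.4).
* [Omeara1963] O. T. O'Meara, *Introduction to Quadratic Forms* (1963), §82F–§82G (hyperbolic planes split
  unimodular lattices).
* [AdkinsWeintraub1992] W. A. Adkins, S. H. Weintraub, *Algebra*, GTM 136, Ch. 6 Thm. (2.35) (Frobenius normal form;
  tree `Literature/LinearAlgebra/FreeModule/AlternatingElementaryDivisors`).
-/

noncomputable section

open Matrix Module

namespace Literature.LinearAlgebra.Matrix

namespace IntegerSymplecticPrimitive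

variable {l : Type*} [Fintype l] [DecidableEq l]

/-! ## §1 The form `B(x, y) = ᵗxJy` on `ℤ^{l ⊕ l}`: alternating, unimodular -/

/-- `B(x, y) = x ⬝ (J y)` unfolded. [folklore] -/
private theorem formJ_apply (x y : l ⊕ l → ℤ) :
    Matrix.toLinearMap₂' ℤ (Matrix.J l ℤ) x y = x ⬝ᵥ (Matrix.J l ℤ *ᵥ y) := by
  rw [Matrix.toLinearMap₂'_apply']

omit [DecidableEq l] in
/-- `ᵗ(Ax) w = ᵗx (ᵗA w)`. [folklore] -/
private theorem mulVec_dotProduct_eq (A : Matrix (l ⊕ l) (l ⊕ l) ℤ) (x w : l ⊕ l → ℤ) :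
    (A *ᵥ x) ⬝ᵥ w = x ⬝ᵥ (Aᵀ *ᵥ w) := by
  rw [dotProduct_mulVec x, vecMul_transpose]

/-- `B` is skew. [folklore] -/
private theorem formJ_swap (x y : l ⊕ l → ℤ) : x ⬝ᵥ (Matrix.J l ℤ *ᵥ y) = -(y ⬝ᵥ (Matrix.J l ℤ *ᵥ x)) := by
  rw [dotProduct_comm y, mulVec_dotProduct_eq, Matrix.J_transpose, neg_mulVec, dotProduct_neg, neg_neg]

/-- `B` is alternating. [folklore] -/
private theorem formJ_self (x : l ⊕ l → ℤ) : x ⬝ᵥ (Matrix.J l ℤ *ᵥ x) = 0 := by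
  have h := formJ_swap x x
  omega

/-- `B` is alternating, as a `BilinForm`. [folklore] -/
private theorem formJ_isAlt : (Matrix.toLinearMap₂' ℤ (Matrix.J l ℤ) : LinearMap.BilinForm ℤ (l ⊕ l → ℤ)).IsAlt := by
  intro x
  rw [formJ_apply]
  exact formJ_self x

/-- `B` is non-degenerate on `ℤ^{l ⊕ l}` (`J² = −1`). [folklore] -/
private theorem eq_zero_of_forall_formJ_eq_zero {x : l ⊕ l → ℤ} (hx : ∀ y, x ⬝ᵥ (Matrix.J l ℤ *ᵥ y) = 0) :
    x = 0 := by
  have h1 : x ᵥ* Matrix.J l ℤ = 0 := by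
    ext i
    have := hx (Pi.single i 1)
    rwa [dotProduct_mulVec, dotProduct_single, mul_one] at this
  have h2 : x ᵥ* Matrix.J l ℤ ᵥ* Matrix.J l ℤ = x ᵥ* (-1 : Matrix (l ⊕ l) (l ⊕ l) ℤ) := by
    rw [vecMul_vecMul, Matrix.J_squared]
  rw [h1, zero_vecMul, vecMul_neg, vecMul_one] at h2
  exact neg_eq_zero.1 h2.symm

/-- `B` is UNIMODULAR on `ℤ^{l ⊕ l}`: the functional `z ↦ c ⬝ z` is `B(Jc, ·)`. [folklore] -/
private theorem formJ_J_mulVec (c z : l ⊕ l → ℤ) : (Matrix.J l ℤ *ᵥ c) ⬝ᵥ (Matrix.J l ℤ *ᵥ z) = c ⬝ᵥ z := by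
  rw [mulVec_dotProduct_eq, mulVec_mulVec, Matrix.J_transpose, Matrix.neg_mul, Matrix.J_squared, neg_neg, one_mulVec]

/-- `J(Jc) = −c`. [folklore] -/
private theorem J_mulVec_J_mulVec (c : l ⊕ l → ℤ) : Matrix.J l ℤ *ᵥ (Matrix.J l ℤ *ᵥ c) = -c := by
  rw [mulVec_mulVec, Matrix.J_squared, neg_mulVec, one_mulVec]

/-- A linear functional on `ℤ^{l ⊕ l}` is `z ↦ c_F ⬝ z` with `c_F(k) = F(e_k)`. [folklore] -/
private theorem linearMap_apply_eq_dotProduct (F : (l ⊕ l → ℤ) →ₗ[ℤ] ℤ) (z : l ⊕ l → ℤ) :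
    F z = (fun k => F (fun j => if k = j then 1 else 0)) ⬝ᵥ z := by
  conv_lhs => rw [pi_eq_sum_univ z]
  rw [map_sum]
  simp only [map_smul, smul_eq_mul, dotProduct]
  exact Finset.sum_congr rfl fun k _ => mul_comm _ _

/-! ## §2 A primitive vector is the first vector of an integral symplectic basis -/

/-- **Core construction.**  For `v ∈ ℤ^{l ⊕ l}` with `v ⬝ c = 1` (primitive) there are families
`u, u' : Fin (n+1) → ℤ^{l ⊕ l}` with `u 0 = v`, the symplectic relations `B(uᵢ, uⱼ) = B(u'ᵢ, u'ⱼ) = 0`,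
`B(uᵢ, u'ⱼ) = δᵢⱼ`, and `n + 1 = #l` — a hyperbolic partner `w = −Jc` of `v`, Frobenius' normal form on the
`B`-orthogonal complement of `⟨v, w⟩` (the tree's `FreeModule.exists_frobeniusBasis`), and all elementary divisors
`= 1` by unimodularity of `B` on `ℤ^{l ⊕ l}`. [cite: Omeara1963, §82F–§82G] [cite: GoreskyTai2017RealStructuresOrdinary, App. §19.2 proof of Lemma 45 («a lemma of Siegel»)] -/
private theorem exists_symplectic_families_cons {v c : l ⊕ l → ℤ} (hvc : v ⬝ᵥ c = 1) :
    ∃ (n : ℕ) (u u' : Fin (n + 1) → (l ⊕ l → ℤ)), u 0 = v ∧ Fintype.card (Fin (n + 1)) = Fintype.card l ∧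
      (∀ i j, u i ⬝ᵥ (Matrix.J l ℤ *ᵥ u j) = 0) ∧ (∀ i j, u' i ⬝ᵥ (Matrix.J l ℤ *ᵥ u' j) = 0) ∧
      ∀ i j, u i ⬝ᵥ (Matrix.J l ℤ *ᵥ u' j) = if i = j then 1 else 0 := by
  classical
  set B : LinearMap.BilinForm ℤ (l ⊕ l → ℤ) := Matrix.toLinearMap₂' ℤ (Matrix.J l ℤ) with hB
  have hBap : ∀ x y, B x y = x ⬝ᵥ (Matrix.J l ℤ *ᵥ y) := formJ_apply
  -- the hyperbolic partner `w = -Jc`: `B(v, w) = v ⬝ c = 1`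
  set w : l ⊕ l → ℤ := -(Matrix.J l ℤ *ᵥ c) with hw
  have hvw : B v w = 1 := by rw [hBap, hw, mulVec_neg, J_mulVec_J_mulVec, neg_neg, hvc]
  have hwv : B w v = -1 := by rw [hBap, formJ_swap, ← hBap, hvw]
  have hvv : B v v = 0 := by rw [hBap]; exact formJ_self v
  have hww : B w w = 0 := by rw [hBap]; exact formJ_self w
  -- the `B`-orthogonal complement `Λ'` of `⟨v, w⟩` and the decomposition `z = -B(w,z) v + B(v,z) w + z'`
  set Λ' : Submodule ℤ (l ⊕ l → ℤ) := LinearMap.ker (B v) ⊓ LinearMap.ker (B w) with hΛ'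
  have hmem : ∀ {y}, y ∈ Λ' ↔ B v y = 0 ∧ B w y = 0 := fun {y} => by
    rw [hΛ', Submodule.mem_inf, LinearMap.mem_ker, LinearMap.mem_ker]
  have hD : ∀ z, z + (B w z) • v - (B v z) • w ∈ Λ' := fun z => by
    rw [hmem]
    constructor
    · rw [map_sub, map_add, map_smul, map_smul, smul_eq_mul, smul_eq_mul, hvv, hvw]; ring
    · rw [map_sub, map_add, map_smul, map_smul, smul_eq_mul, smul_eq_mul, hwv, hww]; ring
  -- `B|Λ'` is alternating and non-degenerate
  set E : LinearMap.BilinForm ℤ Λ' := LinearMap.BilinForm.restrict B Λ' with hE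
  have hEap : ∀ x y : Λ', E x y = B (x : l ⊕ l → ℤ) (y : l ⊕ l → ℤ) := fun x y => rfl
  have hEa : E.IsAlt := fun x => by rw [hEap, hBap]; exact formJ_self _
  have hsep : ∀ x : Λ', (∀ y : Λ', E x y = 0) → x = 0 := by
    intro x hx
    have hx' := (hmem.1 x.2)
    have hxv : B (x : l ⊕ l → ℤ) v = 0 := by rw [hBap, formJ_swap, ← hBap, hx'.1, neg_zero]
    have hxw : B (x : l ⊕ l → ℤ) w = 0 := by rw [hBap, formJ_swap, ← hBap, hx'.2, neg_zero]
    have hall : ∀ z, B (x : l ⊕ l → ℤ) z = 0 := fun z => by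
      have hz := hx ⟨_, hD z⟩
      rw [hEap] at hz
      change B (x : l ⊕ l → ℤ) (z + (B w z) • v - (B v z) • w) = 0 at hz
      rw [map_sub, map_add, map_smul, map_smul, smul_eq_mul, smul_eq_mul, hxv, hxw, mul_zero, mul_zero,
        add_zero, sub_zero] at hz
      exact hz
    exact Subtype.ext (eq_zero_of_forall_formJ_eq_zero fun z => by rw [← hBap]; exact hall z)
  have hEn : E.Nondegenerate := by
    refine ⟨fun x hx => hsep x hx, fun y hy => hsep y fun x => ?_⟩
    rw [← hEa.neg_eq, hy, neg_zero]
  -- Frobenius on `Λ'`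
  obtain ⟨n, b, d, hdpos, -, h11, h22, h12⟩ := Literature.LinearAlgebra.FreeModule.exists_frobeniusBasis E hEa hEn
  -- the full families
  set u : Fin (n + 1) → (l ⊕ l → ℤ) := Fin.cons v fun j => (b (Sum.inl j) : l ⊕ l → ℤ) with hu
  set u' : Fin (n + 1) → (l ⊕ l → ℤ) := Fin.cons w fun j => (b (Sum.inr j) : l ⊕ l → ℤ) with hu'
  set dd : Fin (n + 1) → ℤ := Fin.cons 1 fun j => (d j : ℤ) with hdd
  have hb1 : ∀ k, B v (b k : l ⊕ l → ℤ) = 0 := fun k => (hmem.1 (b k).2).1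
  have hb2 : ∀ k, B w (b k : l ⊕ l → ℤ) = 0 := fun k => (hmem.1 (b k).2).2
  have hb1' : ∀ k, B (b k : l ⊕ l → ℤ) v = 0 := fun k => by rw [hBap, formJ_swap, ← hBap, hb1, neg_zero]
  have hb2' : ∀ k, B (b k : l ⊕ l → ℤ) w = 0 := fun k => by rw [hBap, formJ_swap, ← hBap, hb2, neg_zero]
  have huu : ∀ i j, B (u i) (u j) = 0 := by
    intro i j
    induction i using Fin.cases with
    | zero =>
      induction j using Fin.cases with
      | zero => simp only [hu, Fin.cons_zero, hvv]
      | succ j => simp only [hu, Fin.cons_zero, Fin.cons_succ, hb1]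
    | succ i =>
      induction j using Fin.cases with
      | zero => simp only [hu, Fin.cons_zero, Fin.cons_succ, hb1']
      | succ j => simp only [hu, Fin.cons_succ, ← hEap, h11]
  have hu'u' : ∀ i j, B (u' i) (u' j) = 0 := by
    intro i j
    induction i using Fin.cases with
    | zero =>
      induction j using Fin.cases with
      | zero => simp only [hu', Fin.cons_zero, hww]
      | succ j => simp only [hu', Fin.cons_zero, Fin.cons_succ, hb2]
    | succ i =>
      induction j using Fin.cases with
      | zero => simp only [hu', Fin.cons_zero, Fin.cons_succ, hb2']
      | succ j => simp only [hu', Fin.cons_succ, ← hEap, h22]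
  have huu' : ∀ i j, B (u i) (u' j) = if i = j then dd i else 0 := by
    intro i j
    induction i using Fin.cases with
    | zero =>
      induction j using Fin.cases with
      | zero => simp only [hu, hu', hdd, Fin.cons_zero, hvw, if_true]
      | succ j => simp only [hu, hu', Fin.cons_zero, Fin.cons_succ, hb1, (Fin.succ_ne_zero j).symm, if_false]
    | succ i =>
      induction j using Fin.cases with
      | zero => simp only [hu, hu', Fin.cons_zero, Fin.cons_succ, hb2', Fin.succ_ne_zero, if_false]
      | succ j => simp only [hu, hu', hdd, Fin.cons_succ, ← hEap, h12, Fin.succ_inj]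
  have hddpos : ∀ i, 0 < dd i := by
    intro i
    induction i using Fin.cases with
    | zero => simp only [hdd, Fin.cons_zero]; exact one_pos
    | succ i => simp only [hdd, Fin.cons_succ]; exact_mod_cast hdpos i
  -- `(u, u')` is a basis of `ℤ^{l ⊕ l}`
  have hli : LinearIndependent ℤ (Sum.elim u u') :=
    Literature.LinearAlgebra.FreeModule.linearIndependent_of_frobenius_relations B (fun i => (hddpos i).ne') huu hu'u'
      huu'
  set S := Submodule.span ℤ (Set.range (Sum.elim u u')) with hS
  have hΛ'S : ∀ x : Λ', (x : l ⊕ l → ℤ) ∈ S := by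
    intro x
    rw [← b.sum_repr x, Submodule.coe_sum]
    refine Submodule.sum_mem _ fun k _ => ?_
    rw [Submodule.coe_smul]
    refine Submodule.smul_mem _ _ ?_
    rcases k with j | j
    · exact Submodule.subset_span ⟨Sum.inl j.succ, by simp only [Sum.elim_inl, hu, Fin.cons_succ]⟩
    · exact Submodule.subset_span ⟨Sum.inr j.succ, by simp only [Sum.elim_inr, hu', Fin.cons_succ]⟩
  have hvS : v ∈ S := Submodule.subset_span ⟨Sum.inl 0, by simp only [Sum.elim_inl, hu, Fin.cons_zero]⟩
  have hwS : w ∈ S := Submodule.subset_span ⟨Sum.inr 0, by simp only [Sum.elim_inr, hu', Fin.cons_zero]⟩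
  have hsp : ⊤ ≤ S := by
    intro z _
    have hz : z = (z + (B w z) • v - (B v z) • w) - (B w z) • v + (B v z) • w := by abel
    rw [hz]
    exact Submodule.add_mem _ (Submodule.sub_mem _ (hΛ'S ⟨_, hD z⟩) (Submodule.smul_mem _ _ hvS))
      (Submodule.smul_mem _ _ hwS)
  let β : Basis (Fin (n + 1) ⊕ Fin (n + 1)) ℤ (l ⊕ l → ℤ) := Basis.mk hli (by rw [← hS]; exact hsp)
  have hβ : ∀ k, β k = Sum.elim u u' k := fun k => Basis.mk_apply hli _ k
  -- cardinality
  have hcard : Fintype.card (Fin (n + 1)) = Fintype.card l := by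
    have h1 := Module.finrank_eq_card_basis β
    rw [Module.finrank_fintype_fun_eq_card, Fintype.card_sum, Fintype.card_sum] at h1
    omega
  -- all elementary divisors are `1` (unimodularity of `B` on `ℤ^{l ⊕ l}`)
  have hunimod : ∀ f : (l ⊕ l → ℤ) →ₗ[ℤ] ℤ, ∃ y, ∀ z, B y z = f z := fun f =>
    ⟨Matrix.J l ℤ *ᵥ fun k => f (fun j => if k = j then 1 else 0), fun z => by
      rw [hBap, formJ_J_mulVec, ← linearMap_apply_eq_dotProduct]⟩
  have hd1 : ∀ i, dd i = 1 := by
    intro i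
    obtain ⟨y, hy⟩ := hunimod (β.coord (Sum.inl i))
    have h1 : B y (β (Sum.inl i)) = 1 := by
      rw [hy, Basis.coord_apply, Basis.repr_self, Finsupp.single_eq_same]
    have hanti₁ : ∀ j, B (β (Sum.inl j)) (β (Sum.inl i)) = 0 := fun j => by rw [hβ, hβ]; exact huu j i
    have hanti₂ : ∀ j, B (β (Sum.inr j)) (β (Sum.inl i)) = -(if i = j then dd i else 0) := fun j => by
      rw [hβ, hβ, Sum.elim_inr, Sum.elim_inl, hBap, formJ_swap, ← hBap, huu']
    have h2 : B y (β (Sum.inl i)) = -(dd i * β.repr y (Sum.inr i)) := by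
      conv_lhs => rw [← β.sum_repr y]
      rw [map_sum, LinearMap.sum_apply, Fintype.sum_sum_type]
      simp only [map_smul, LinearMap.smul_apply, smul_eq_mul, hanti₁, hanti₂, mul_zero,
        Finset.sum_const_zero, zero_add, mul_neg, mul_ite, Finset.sum_neg_distrib, Finset.sum_ite_eq,
        Finset.mem_univ, if_true]
      ring
    have h3 : dd i * -(β.repr y (Sum.inr i)) = 1 := by linear_combination -h2 + h1
    exact Int.eq_one_of_mul_eq_one_right (hddpos i).le h3
  refine ⟨n, u, u', by simp only [hu, Fin.cons_zero], hcard, fun i j => by rw [← hBap]; exact huu i j,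
    fun i j => by rw [← hBap]; exact hu'u' i j, fun i j => ?_⟩
  rw [← hBap, huu', hd1]

/-! ## §3 `Sp_{2n}(ℤ)` moves `e_{i₀}` to any primitive vector, and is transitive on primitive vectors -/

omit [DecidableEq l] in
/-- `(ᵗX M Y)_{ac} = ᵗ(X e_a) M (Y e_c)`.  [folklore] -/
private theorem transpose_mul_mul_apply (X M Y : Matrix (l ⊕ l) (l ⊕ l) ℤ) (a c' : l ⊕ l) :
    (Xᵀ * M * Y) a c' = (fun r => X r a) ⬝ᵥ (M *ᵥ fun r => Y r c') := by
  rw [Matrix.mul_assoc]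
  simp only [mul_apply, transpose_apply, dotProduct, mulVec]

omit [Fintype l] in
/-- The entries of `J = (0 −1; 1 0)`.  [folklore] -/
private theorem J_apply_cases (a c' : l ⊕ l) :
    Matrix.J l ℤ a c' = Sum.elim (fun j => Sum.elim (fun _ => (0 : ℤ)) (fun j' => -(if j = j' then 1 else 0)) c')
      (fun j => Sum.elim (fun j' => if j = j' then 1 else 0) (fun _ => 0) c') a := by
  rcases a with j | j <;> rcases c' with j' | j' <;>
    simp [Matrix.J, fromBlocks_apply₁₁, fromBlocks_apply₁₂, fromBlocks_apply₂₁, fromBlocks_apply₂₂, Matrix.one_apply]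

/-- **A primitive vector is a column of an integral symplectic matrix**: if `v ⬝ c = 1` for some integral `c`
(`v ∈ ℤ^{2n}` primitive, by Bézout) then for every index `i₀` there is `g ∈ Sp_{2n}(ℤ)` with `g e_{i₀} = v`
(`e_{i₀}` the `i₀`-th vector of the first Lagrangian block).  [cite: GoreskyTai2017RealStructuresOrdinary, App. §19.2 proof of Lemma 45 («We claim there exists `g ∈ Sp_{2n}(ℤ)` so that `gv = e_1` … This is a lemma of Siegel (see [Freitag] Satz A5.4)»)] [cite: Omeara1963, §82F–§82G] -/
theorem exists_mem_symplecticGroup_mulVec_single_eq {v c : l ⊕ l → ℤ} (hvc : v ⬝ᵥ c = 1) (i₀ : l) :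
    ∃ g : Matrix (l ⊕ l) (l ⊕ l) ℤ, g ∈ Matrix.symplecticGroup l ℤ ∧ g *ᵥ Pi.single (Sum.inl i₀) 1 = v := by
  classical
  obtain ⟨n, u, u', hu0, hcard, huu, hu'u', huu'⟩ := exists_symplectic_families_cons hvc
  -- index bijection `σ : Fin (n+1) ≃ l` with `σ 0 = i₀`
  let σ₀ : Fin (n + 1) ≃ l := Fintype.equivOfCardEq hcard
  let σ : Fin (n + 1) ≃ l := σ₀.trans (Equiv.swap (σ₀ 0) i₀)
  have hσ : σ 0 = i₀ := by simp [σ, Equiv.swap_apply_left]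
  have hσ' : σ.symm i₀ = 0 := by rw [Equiv.symm_apply_eq]; exact hσ.symm
  -- the matrix with columns `u (σ⁻¹ j)` and `-u' (σ⁻¹ j)`
  let col : l ⊕ l → (l ⊕ l → ℤ) := Sum.elim (fun j => u (σ.symm j)) (fun j => -u' (σ.symm j))
  have hgram : ∀ a c', col a ⬝ᵥ (Matrix.J l ℤ *ᵥ col c') = Matrix.J l ℤ a c' := by
    rintro (j | j) (j' | j') <;> rw [J_apply_cases] <;> simp only [col, Sum.elim_inl, Sum.elim_inr]
    · exact huu _ _
    · rw [mulVec_neg, dotProduct_neg, huu']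
      exact congrArg Neg.neg (if_congr σ.symm.injective.eq_iff rfl rfl)
    · rw [neg_dotProduct, formJ_swap, neg_neg, huu']
      exact if_congr (by rw [σ.symm.injective.eq_iff, eq_comm]) rfl rfl
    · rw [mulVec_neg, dotProduct_neg, neg_dotProduct, neg_neg]
      exact hu'u' _ _
  refine ⟨Matrix.of fun r c' => col c' r, ?_, ?_⟩
  · rw [SymplecticGroup.mem_iff']
    ext a c'
    rw [transpose_mul_mul_apply]
    exact hgram a c'
  · ext r
    simp only [mulVec, dotProduct, of_apply, Pi.single_apply, mul_ite, mul_one, mul_zero, Finset.sum_ite_eq',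
      Finset.mem_univ, if_true]
    simp only [col, Sum.elim_inl, hσ', hu0]

/-- **«There exists `g ∈ Sp_{2n}(ℤ)` so that `gv = e_1`»** (Siegel): a primitive `v ∈ ℤ^{2n}` is moved to the basis
vector `e_{i₀}` by an integral symplectic matrix. [cite: GoreskyTai2017RealStructuresOrdinary, App. §19.2 proof of Lemma 45] [cite: Omeara1963, §82F–§82G] -/
theorem exists_mem_symplecticGroup_mulVec_eq_single {v c : l ⊕ l → ℤ} (hvc : v ⬝ᵥ c = 1) (i₀ : l) :
    ∃ g : Matrix (l ⊕ l) (l ⊕ l) ℤ, g ∈ Matrix.symplecticGroup l ℤ ∧ g *ᵥ v = Pi.single (Sum.inl i₀) 1 := by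
  obtain ⟨g, hg, hgv⟩ := exists_mem_symplecticGroup_mulVec_single_eq hvc i₀
  refine ⟨-(Matrix.J l ℤ * gᵀ * Matrix.J l ℤ), SymplecticGroup.neg_mem
    (Submonoid.mul_mem _ (Submonoid.mul_mem _ (SymplecticGroup.J_mem l ℤ) (SymplecticGroup.transpose_mem hg))
      (SymplecticGroup.J_mem l ℤ)), ?_⟩
  rw [← hgv, mulVec_mulVec, Matrix.neg_mul, SymplecticGroup.inv_left_mul_aux hg, one_mulVec]

/-- **`Sp_{2n}(ℤ)` acts transitively on primitive vectors of `ℤ^{2n}`** (Siegel's lemma, [Freitag] Satz A5.4, as used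
by Goresky–Tai): if `v ⬝ c = 1` and `v′ ⬝ c′ = 1` then `hv = v′` for some `h ∈ Sp_{2n}(ℤ)`.
[cite: GoreskyTai2017RealStructuresOrdinary, App. §19.2 proof of Lemma 45 («This is a lemma of Siegel (see [Freitag] Satz A5.4)»)] [cite: Omeara1963, §82F–§82G] -/
theorem exists_mem_symplecticGroup_mulVec_eq {v c v' c' : l ⊕ l → ℤ} (hvc : v ⬝ᵥ c = 1) (hvc' : v' ⬝ᵥ c' = 1) :
    ∃ h : Matrix (l ⊕ l) (l ⊕ l) ℤ, h ∈ Matrix.symplecticGroup l ℤ ∧ h *ᵥ v = v' := by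
  have hne : Nonempty l := by
    by_contra h
    rw [not_nonempty_iff] at h
    rw [dotProduct, Finset.univ_eq_empty, Finset.sum_empty] at hvc
    exact zero_ne_one hvc
  obtain ⟨i₀⟩ := hne
  obtain ⟨g, hg, hgv⟩ := exists_mem_symplecticGroup_mulVec_eq_single hvc i₀
  obtain ⟨g', hg', hg'v⟩ := exists_mem_symplecticGroup_mulVec_single_eq hvc' i₀
  exact ⟨g' * g, Submonoid.mul_mem _ hg' hg, by rw [← mulVec_mulVec, hgv, hg'v]⟩

/-- **Conversely, columns of integral symplectic matrices are primitive**: if `g ∈ Sp_{2n}(ℤ)` then `v = g e_{i₀}`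
satisfies `v ⬝ c = 1` with `c` the `i₀`-th row of `g⁻¹ = −JᵗgJ`. [cite: GoreskyTai2017RealStructuresOrdinary, App. §19.2 proof of Lemma 45] -/
theorem exists_dotProduct_eq_one_of_mem_symplecticGroup {g : Matrix (l ⊕ l) (l ⊕ l) ℤ}
    (hg : g ∈ Matrix.symplecticGroup l ℤ) (i₀ : l) :
    ∃ c : l ⊕ l → ℤ, (g *ᵥ Pi.single (Sum.inl i₀) 1) ⬝ᵥ c = 1 := by
  classical
  refine ⟨fun k => (-(Matrix.J l ℤ * gᵀ * Matrix.J l ℤ)) (Sum.inl i₀) k, ?_⟩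
  have h : (-(Matrix.J l ℤ * gᵀ * Matrix.J l ℤ)) *ᵥ (g *ᵥ Pi.single (Sum.inl i₀) 1) = Pi.single (Sum.inl i₀) 1 := by
    rw [mulVec_mulVec, Matrix.neg_mul, SymplecticGroup.inv_left_mul_aux hg, one_mulVec]
  have h' := congr_fun h (Sum.inl i₀)
  rw [Pi.single_eq_same, mulVec, dotProduct] at h'
  rw [dotProduct]
  calc ∑ k, (g *ᵥ Pi.single (Sum.inl i₀) 1) k * (-(Matrix.J l ℤ * gᵀ * Matrix.J l ℤ)) (Sum.inl i₀) k
      = ∑ k, (-(Matrix.J l ℤ * gᵀ * Matrix.J l ℤ)) (Sum.inl i₀) k * (g *ᵥ Pi.single (Sum.inl i₀) 1) k :=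
        Finset.sum_congr rfl fun k _ => mul_comm _ _
    _ = 1 := h'

/-! ## §4 The first reduction step of Goresky–Tai's Lemma 45: a primitive `τ`-fixed vector, moved to `e_1` -/

omit [DecidableEq l] in
/-- **Bézout for a family**: a non-zero integral vector is `d • v` with `v` primitive in Bézout form (`v ⬝ c = 1`),
`d = gcd` of the entries («divide by common divisors to obtain a primitive vector»).
[cite: GoreskyTai2017RealStructuresOrdinary, App. §19.2 proof of Lemma 45] -/
theorem exists_eq_smul_primitive {ι : Type*} [Fintype ι] {u : ι → ℤ} (hu : u ≠ 0) :
    ∃ (d : ℤ) (v c : ι → ℤ), d ≠ 0 ∧ u = d • v ∧ v ⬝ᵥ c = 1 := by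
  classical
  set d := Finset.univ.gcd u with hd
  have hd0 : d ≠ 0 := by
    intro h
    rw [hd, Finset.gcd_eq_zero_iff] at h
    exact hu (funext fun k => h k (Finset.mem_univ k))
  have hdvd : ∀ k, d ∣ u k := fun k => Finset.gcd_dvd (Finset.mem_univ k)
  obtain ⟨g, hg⟩ := Finset.gcd_eq_sum_mul Finset.univ u
  refine ⟨d, fun k => u k / d, g, hd0, ?_, ?_⟩
  · funext k
    rw [Pi.smul_apply, smul_eq_mul, Int.mul_ediv_cancel' (hdvd k)]
  · have h1 : d * ((fun k => u k / d) ⬝ᵥ g) = d * 1 := by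
      rw [mul_one, dotProduct, Finset.mul_sum]
      conv_rhs => rw [hd, hg]
      exact Finset.sum_congr rfl fun k _ => by rw [← mul_assoc, Int.mul_ediv_cancel' (hdvd k)]
    exact mul_left_cancel₀ hd0 h1

omit [DecidableEq l] in
/-- **«There exists a vector `v ∈ ℤ^{2n}` that is primitive and has `τ(v) = v`»** — for any integral matrix `τ` with
`τ² = 1` and `τ ≠ −1` (any finite index type): `τx + x ≠ 0` for some `x`, it is `τ`-fixed, and its primitive part
is `τ`-fixed as well. [cite: GoreskyTai2017RealStructuresOrdinary, App. §19.2 proof of Lemma 45] -/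
theorem exists_primitive_mulVec_eq_self {ι : Type*} [Fintype ι] [DecidableEq ι] {τ : Matrix ι ι ℤ}
    (hττ : τ * τ = 1) (hτ : τ ≠ -1) :
    ∃ v c : ι → ℤ, v ⬝ᵥ c = 1 ∧ τ *ᵥ v = v := by
  -- some column of `τ + 1` is non-zero
  have hne : ∃ k, (τ + 1) *ᵥ Pi.single k 1 ≠ 0 := by
    by_contra h
    simp only [not_exists, ne_eq, not_not] at h
    apply hτ
    rw [← sub_eq_zero, sub_neg_eq_add]
    ext i k
    have hk := congr_fun (h k) i
    rw [mulVec_single_one, Matrix.col_apply, Pi.zero_apply] at hk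
    rw [Matrix.zero_apply]
    exact hk
  obtain ⟨k, hk⟩ := hne
  set x : ι → ℤ := (τ + 1) *ᵥ Pi.single k 1 with hx
  have hτx : τ *ᵥ x = x := by
    rw [hx, mulVec_mulVec, Matrix.mul_add, Matrix.mul_one, hττ, add_comm]
  obtain ⟨d, v, c, hd0, hxv, hvc⟩ := exists_eq_smul_primitive hk
  refine ⟨v, c, hvc, ?_⟩
  have h : d • (τ *ᵥ v) = d • v := by rw [← mulVec_smul, ← hxv, hτx]
  exact smul_right_injective _ hd0 h

/-- The `(inr i₀)`-ROW of a multiplier-`(−1)` involution fixing `e_{inl i₀}` is `−ᵗe_{inr i₀}`: from `ᵗτJτ = −J` and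
`τ² = 1`, `ᵗτJ = −Jτ`, and `Je_{inl i₀} = e_{inr i₀}` — GT's shape «`C = (0 0; 0 C₁)`, `D = (−1 0; * D₁)`» of the
row through the fixed vector. [cite: GoreskyTai2017RealStructuresOrdinary, App. §19.2 proof of Lemma 45] -/
theorem row_inr_eq_of_mulVec_single_eq {τ : Matrix (l ⊕ l) (l ⊕ l) ℤ} (hττ : τ * τ = 1)
    (hJ : τᵀ * Matrix.J l ℤ * τ = -Matrix.J l ℤ) {i₀ : l} (hfix : τ *ᵥ Pi.single (Sum.inl i₀) 1 = Pi.single (Sum.inl i₀) 1) :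
    ∀ k, τ (Sum.inr i₀) k = -(Pi.single (Sum.inr i₀) (1 : ℤ) : l ⊕ l → ℤ) k := by
  -- `ᵗτ J = -J τ`
  have h1 : τᵀ * Matrix.J l ℤ = -(Matrix.J l ℤ * τ) := by
    have h : τᵀ * Matrix.J l ℤ * τ * τ = -Matrix.J l ℤ * τ := congrArg (· * τ) hJ
    rw [Matrix.mul_assoc, hττ, Matrix.mul_one, Matrix.neg_mul] at h
    exact h
  -- apply both sides to `e_{inl i₀}`
  have h2 : (τᵀ * Matrix.J l ℤ) *ᵥ Pi.single (Sum.inl i₀) 1 = -((Matrix.J l ℤ * τ) *ᵥ Pi.single (Sum.inl i₀) 1) := by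
    rw [h1, neg_mulVec]
  rw [← mulVec_mulVec, ← mulVec_mulVec, hfix] at h2
  -- `J e_{inl i₀} = e_{inr i₀}`
  have hJe : Matrix.J l ℤ *ᵥ Pi.single (Sum.inl i₀) 1 = Pi.single (Sum.inr i₀) 1 := by
    ext r
    rw [mulVec_single_one]
    rcases r with j | j
    · simp [Matrix.J, fromBlocks_apply₁₁]
    · simp [Matrix.J, fromBlocks_apply₂₁, Pi.single_apply, Matrix.one_apply, Sum.inr.injEq]
  rw [hJe] at h2
  intro k
  have hk := congr_fun h2 k
  rw [mulVec_single_one, Matrix.col_apply, transpose_apply, Pi.neg_apply] at hk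
  exact hk

/-- **The first reduction step of Lemma 45, assembled**: an integral involution `τ` (`τ² = 1`) of multiplier `−1`
(`ᵗτJτ = −J`) with `τ ≠ −1`... (in fact `τ ≠ −1` is automatic, `−1` having multiplier `+1`; we derive it) is
`Sp_{2n}(ℤ)`-conjugate to `τ′ = g′τg` (`g, g′ ∈ Sp_{2n}(ℤ)`, `g′g = 1`) with `τ′e_{inl i₀} = e_{inl i₀}` and
`(inr i₀)`-row `−ᵗe_{inr i₀}` — «It follows that `τ` is `Sp_{2n}(ℤ)` conjugate to a matrix `(A B; C D)` where
`A = (1 *; 0 A₁)`, … `C = (0 0; 0 C₁)`, `D = (−1 0; * D₁)`»; `τ′` is again an involution of multiplier `−1`.  (The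
ensuing induction on `n` — «`(A₁ B₁; C₁ D₁) ∈ GSp_{2n−2}(ℤ)` is an involution with multiplier equal to `−1`.  By
induction …» — is not formalized here.) [cite: GoreskyTai2017RealStructuresOrdinary, App. §19.2 proof of Lemma 45] -/
theorem exists_symplectic_conj_mulVec_single_eq_self [Nonempty l] {τ : Matrix (l ⊕ l) (l ⊕ l) ℤ} (hττ : τ * τ = 1)
    (hJ : τᵀ * Matrix.J l ℤ * τ = -Matrix.J l ℤ) (i₀ : l) :
    ∃ g g' : Matrix (l ⊕ l) (l ⊕ l) ℤ, g ∈ Matrix.symplecticGroup l ℤ ∧ g' ∈ Matrix.symplecticGroup l ℤ ∧ g' * g = 1 ∧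
      (g' * τ * g) *ᵥ Pi.single (Sum.inl i₀) 1 = Pi.single (Sum.inl i₀) 1 ∧
      (∀ k, (g' * τ * g) (Sum.inr i₀) k = -(Pi.single (Sum.inr i₀) (1 : ℤ) : l ⊕ l → ℤ) k) ∧
      (g' * τ * g) * (g' * τ * g) = 1 ∧ (g' * τ * g)ᵀ * Matrix.J l ℤ * (g' * τ * g) = -Matrix.J l ℤ := by
  classical
  -- `τ ≠ -1`: `-1` has multiplier `+1 ≠ -1`
  have hτ : τ ≠ -1 := by
    rintro rfl
    rw [transpose_neg, transpose_one, Matrix.neg_mul, Matrix.one_mul, Matrix.mul_neg, Matrix.mul_one, neg_neg] at hJ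
    have h := congr_fun (congr_fun hJ (Sum.inr (Classical.arbitrary l))) (Sum.inl (Classical.arbitrary l))
    simp [Matrix.J, fromBlocks_apply₂₁] at h
  obtain ⟨v, c, hvc, hτv⟩ := exists_primitive_mulVec_eq_self hττ hτ
  obtain ⟨g, hg, hgv⟩ := exists_mem_symplecticGroup_mulVec_single_eq hvc i₀
  set g' : Matrix (l ⊕ l) (l ⊕ l) ℤ := -(Matrix.J l ℤ * gᵀ * Matrix.J l ℤ) with hg'def
  have hg' : g' ∈ Matrix.symplecticGroup l ℤ := SymplecticGroup.neg_mem
    (Submonoid.mul_mem _ (Submonoid.mul_mem _ (SymplecticGroup.J_mem l ℤ) (SymplecticGroup.transpose_mem hg))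
      (SymplecticGroup.J_mem l ℤ))
  have hg'g : g' * g = 1 := by rw [hg'def, Matrix.neg_mul, SymplecticGroup.inv_left_mul_aux hg]
  have hgg' : g * g' = 1 := mul_eq_one_comm.1 hg'g
  have hfix : (g' * τ * g) *ᵥ Pi.single (Sum.inl i₀) 1 = Pi.single (Sum.inl i₀) 1 := by
    rw [← mulVec_mulVec, ← mulVec_mulVec, hgv, hτv, ← hgv, mulVec_mulVec, hg'g, one_mulVec]
  have hsq : (g' * τ * g) * (g' * τ * g) = 1 := by
    calc (g' * τ * g) * (g' * τ * g) = g' * τ * (g * g') * τ * g := by simp only [Matrix.mul_assoc]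
      _ = 1 := by rw [hgg', Matrix.mul_one, Matrix.mul_assoc g', hττ, Matrix.mul_one, hg'g]
  have hg't : g'ᵀ * Matrix.J l ℤ * g' = Matrix.J l ℤ := SymplecticGroup.mem_iff'.1 hg'
  have hgt : gᵀ * Matrix.J l ℤ * g = Matrix.J l ℤ := SymplecticGroup.mem_iff'.1 hg
  have hmult : (g' * τ * g)ᵀ * Matrix.J l ℤ * (g' * τ * g) = -Matrix.J l ℤ := by
    rw [transpose_mul, transpose_mul]
    calc gᵀ * (τᵀ * g'ᵀ) * Matrix.J l ℤ * (g' * τ * g) = gᵀ * (τᵀ * (g'ᵀ * Matrix.J l ℤ * g') * τ) * g := by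
          simp only [Matrix.mul_assoc]
      _ = -Matrix.J l ℤ := by rw [hg't, hJ, Matrix.mul_neg, Matrix.neg_mul, hgt]
  exact ⟨g, g', hg, hg', hg'g, hfix, row_inr_eq_of_mulVec_single_eq hsq hmult hfix, hsq, hmult⟩

end IntegerSymplecticPrimitive

end Literature.LinearAlgebra.Matrix
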